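import Mathlib.MeasureTheory.Constructions.Cylinders
import Mathlib.MeasureTheory.Measure.Typeclasses.Finite
import Mathlib.MeasureTheory.Integral.Lebesgue.Basic
import Mathlib.Logic.Function.DependsOn
import HarnessLib

/-!
# Measures on `ℤ`-indexed configurations are determined by their laws on windows

Topic `Literature/Probability/LatticeModels`; theorems only (no definitions, no named facts).
Generic measure theory on the configuration space `ℤ → S` of a one-dimensional lattice system:
the cylinder events based on the WINDOWS (integer intervals) `{a, …, b}` with `a ≤ 0 ≤ b` form a
π-system generating the product σ-algebra, so two finite measures with the same laws on all such
windows — equivalently, the same integrals of all window-local non-negative observables — coincide.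
This is the uniqueness half of the description of a measure on `ℤ → S` by its finite-window
marginals (Kolmogorov; Georgii 2011, §1.1–1.2, proof of Thm 1.6 / Rem. 1.24: "events depending on
finitely many coordinates generate"), used to identify limits of finite-volume constructions, to
verify DLR equations on cylinder events, and to prove shift invariance from window laws.

* `cylinder_eq_cylinder_Icc` — a cylinder over any finite `s ⊆ ℤ` is a cylinder over a window
  `{-(n), …, n}`;
* `isPiSystem_IccCylinders`, `generateFrom_IccCylinders` — the window cylinders (windows
  containing `0`) form a generating π-system;
* `Measure.ext_of_IccCylinders` — finite measures agreeing on window cylinders are equal;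
* `Measure.ext_of_lintegral_dependsOn_Icc` — finite measures with equal integrals of all measurable
  `ℝ≥0∞`-valued observables depending only on the coordinates in a window (Mathlib `DependsOn`)
  are equal.

## References

* H.-O. Georgii, *Gibbs Measures and Phase Transitions*, 2nd ed. (2011), §1.1–1.2. [Georgii2011]
-/

noncomputable section

open MeasureTheory Set Function
open scoped ENNReal

namespace Literature.Probability.LatticeModels

variable {S : Type*} [MeasurableSpace S]

/-! ### Window cylinders -/

omit [MeasurableSpace S] in
/-- A cylinder over `s` is a cylinder over any larger index set `t ⊇ s`
(base `restrict₂⁻¹' B`). [folklore] -/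
theorem cylinder_eq_cylinder_of_subset {s t : Finset ℤ} (hst : s ⊆ t) (B : Set (s → S)) :
    cylinder s B = cylinder (α := fun _ : ℤ => S) t
      (Finset.restrict₂ (π := fun _ : ℤ => S) hst ⁻¹' B) := by
  ext σ
  simp only [mem_cylinder, mem_preimage]
  exact Iff.rfl

omit [MeasurableSpace S] in
/-- Every finite `s ⊆ ℤ` lies in a symmetric window `{-n, …, n}` (a private copy of the
elementary fact also recorded as `Literature.NumberTheory.Sieve.Polymath8a.exists_subset_Icc_neg`,
not imported here to keep the import cone topical). [folklore] -/
private theorem exists_subset_Icc_neg_nat (s : Finset ℤ) :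
    ∃ n : ℕ, s ⊆ Finset.Icc (-(n : ℤ)) n := by
  refine ⟨s.sup Int.natAbs, fun k hk => ?_⟩
  have := Finset.le_sup (f := Int.natAbs) hk
  rw [Finset.mem_Icc]; omega

omit [MeasurableSpace S] in
/-- **A cylinder over any finite index set is a cylinder over a window `{-n, …, n}`.** [folklore] -/
theorem cylinder_eq_cylinder_Icc (s : Finset ℤ) (B : Set (s → S)) :
    ∃ (n : ℕ) (h : s ⊆ Finset.Icc (-(n : ℤ)) n),
      cylinder s B = cylinder (α := fun _ : ℤ => S) (Finset.Icc (-(n : ℤ)) n)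
        (Finset.restrict₂ (π := fun _ : ℤ => S) h ⁻¹' B) := by
  obtain ⟨n, hn⟩ := exists_subset_Icc_neg_nat s
  exact ⟨n, hn, cylinder_eq_cylinder_of_subset hn B⟩

/-- **The window cylinders form a π-system**: cylinders based on windows `{a, …, b}` with
`a ≤ 0 ≤ b` and measurable bases are closed under (nonempty) intersections — two windows
containing `0` lie in the window `{min a₁ a₂, …, max b₁ b₂}`, over which both cylinders can be
rewritten (Georgii 2011, §1.1). [cite: Georgii2011, §1.1] -/
theorem isPiSystem_IccCylinders :
    IsPiSystem {A : Set (ℤ → S) | ∃ (a b : ℤ) (B : Set (Finset.Icc a b → S)),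
      a ≤ 0 ∧ 0 ≤ b ∧ MeasurableSet B ∧ A = cylinder (Finset.Icc a b) B} := by
  rintro A₁ ⟨a₁, b₁, B₁, ha₁, hb₁, hB₁, rfl⟩ A₂ ⟨a₂, b₂, B₂, ha₂, hb₂, hB₂, rfl⟩ -
  set a := min a₁ a₂ with ha
  set b := max b₁ b₂ with hb
  have h₁ : Finset.Icc a₁ b₁ ⊆ Finset.Icc a b :=
    Finset.Icc_subset_Icc (min_le_left _ _) (le_max_left _ _)
  have h₂ : Finset.Icc a₂ b₂ ⊆ Finset.Icc a b :=
    Finset.Icc_subset_Icc (min_le_right _ _) (le_max_right _ _)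
  refine ⟨a, b, Finset.restrict₂ (π := fun _ : ℤ => S) h₁ ⁻¹' B₁ ∩
    Finset.restrict₂ (π := fun _ : ℤ => S) h₂ ⁻¹' B₂, ?_, ?_, ?_, ?_⟩
  · exact (min_le_left _ _).trans ha₁
  · exact hb₁.trans (le_max_left _ _)
  · exact ((Finset.measurable_restrict₂ h₁) hB₁).inter ((Finset.measurable_restrict₂ h₂) hB₂)
  · rw [cylinder_eq_cylinder_of_subset h₁ B₁, cylinder_eq_cylinder_of_subset h₂ B₂]
    ext σ
    simp only [mem_inter_iff, mem_cylinder, mem_preimage]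

/-- **The window cylinders generate the product σ-algebra** on `ℤ → S` (every measurable cylinder
is a window cylinder, and the measurable cylinders generate, Mathlib
`generateFrom_measurableCylinders`) (Georgii 2011, §1.1). [cite: Georgii2011, §1.1] -/
theorem generateFrom_IccCylinders :
    MeasurableSpace.generateFrom {A : Set (ℤ → S) | ∃ (a b : ℤ) (B : Set (Finset.Icc a b → S)),
      a ≤ 0 ∧ 0 ≤ b ∧ MeasurableSet B ∧ A = cylinder (Finset.Icc a b) B} =
      MeasurableSpace.pi := by
  apply le_antisymm
  · refine MeasurableSpace.generateFrom_le fun A hA => ?_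
    obtain ⟨a, b, B, -, -, hB, rfl⟩ := hA
    exact MeasurableSet.cylinder (α := fun _ : ℤ => S) _ hB
  · rw [← generateFrom_measurableCylinders]
    refine MeasurableSpace.generateFrom_mono fun A hA => ?_
    obtain ⟨s, B, hB, rfl⟩ := (mem_measurableCylinders A).1 hA
    obtain ⟨n, hsub, heq⟩ := cylinder_eq_cylinder_Icc s B
    refine ⟨-(n : ℤ), n, _, by omega, by omega, (Finset.measurable_restrict₂ hsub) hB, heq⟩

/-- **Finite measures on `ℤ → S` agreeing on all window cylinders are equal** (windows
`{a, …, b}` with `a ≤ 0 ≤ b`, measurable bases) (Georgii 2011, §1.1–1.2; Dynkin's π-λ theorem,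
Mathlib `ext_of_generate_finite`). [cite: Georgii2011, §1.1] -/
theorem Measure.ext_of_IccCylinders {μ ν : Measure (ℤ → S)} [IsFiniteMeasure μ]
    (h : ∀ (a b : ℤ), a ≤ 0 → 0 ≤ b → ∀ B : Set (Finset.Icc a b → S), MeasurableSet B →
      μ (cylinder (Finset.Icc a b) B) = ν (cylinder (Finset.Icc a b) B)) :
    μ = ν := by
  refine ext_of_generate_finite _ generateFrom_IccCylinders.symm isPiSystem_IccCylinders ?_ ?_
  · rintro A ⟨a, b, B, ha, hb, hB, rfl⟩
    exact h a b ha hb B hB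
  · have h0 := h 0 0 le_rfl le_rfl univ MeasurableSet.univ
    simpa [cylinder] using h0

omit [MeasurableSpace S] in
/-- The indicator of a cylinder over `s` depends only on the coordinates in `s`. [folklore] -/
theorem dependsOn_indicator_cylinder (s : Finset ℤ) (B : Set (s → S)) (c : ℝ≥0∞) :
    DependsOn ((cylinder s B).indicator fun _ : ℤ → S => c) (s : Set ℤ) := by
  intro σ σ' hσ
  have hres : s.restrict σ = s.restrict σ' := funext fun i => hσ i i.2
  by_cases hmem : σ ∈ cylinder s B
  · have hmem' : σ' ∈ cylinder s B := by
      rw [mem_cylinder] at hmem ⊢; rwa [← hres]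
    rw [indicator_of_mem hmem, indicator_of_mem hmem']
  · have hmem' : σ' ∉ cylinder s B := by
      rw [mem_cylinder] at hmem ⊢; rwa [← hres]
    rw [indicator_of_notMem hmem, indicator_of_notMem hmem']

/-- **Finite measures on `ℤ → S` with the same integrals of all window-local observables are
equal**: if `∫ f dμ = ∫ f dν` for every measurable `f ≥ 0` depending only on the coordinates in a
window `{a, …, b}` (`a ≤ 0 ≤ b`; Mathlib `DependsOn`), then `μ = ν`
(Georgii 2011, §1.1–1.2). [cite: Georgii2011, §1.1] -/
theorem Measure.ext_of_lintegral_dependsOn_Icc {μ ν : Measure (ℤ → S)} [IsFiniteMeasure μ]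
    (h : ∀ (a b : ℤ), a ≤ 0 → 0 ≤ b → ∀ f : (ℤ → S) → ℝ≥0∞, Measurable f →
      DependsOn f (Finset.Icc a b : Set ℤ) → ∫⁻ σ, f σ ∂μ = ∫⁻ σ, f σ ∂ν) :
    μ = ν := by
  refine Measure.ext_of_IccCylinders fun a b ha hb B hB => ?_
  have hmeas : MeasurableSet (cylinder (Finset.Icc a b) B) :=
    MeasurableSet.cylinder (α := fun _ : ℤ => S) _ hB
  rw [← lintegral_indicator_one hmeas, ← lintegral_indicator_one hmeas]
  refine h a b ha hb _ (measurable_one.indicator hmeas) ?_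
  exact dependsOn_indicator_cylinder (S := S) (Finset.Icc a b) B 1

end Literature.Probability.LatticeModels
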